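import Summits.BirchSwinnertonDyer.Rank1Residual.F1Sign2.SelfTwistAtTwo
import HarnessLib.Audit.Tags
import Literature.NumberTheory.EllipticCurves.Selmer
import Literature.NumberTheory.EllipticCurves.RootNumber
import Literature.NumberTheory.EllipticCurves.BSDRankZeroDensity
import HarnessLib

/-!
# Cell `bsd-f1-sign2` — analytic lens (planner `-an` g21; MEMO-an v1.62-add2 and -add3 §24.9–§24.10): «THE 2-SELMER STOREY OF THE CUBIC DICTIONARY»
# — `#Sel₂(E/ℚ) = #Hom(Cl_{𝔮²}(F₃), ±1)` (Δ < 0) / within one (Δ > 0), the cubic ROOT-NUMBER LAW `w(E) = (−1)^{rk₂ Cl_{𝔮²}(F₃)}`,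
# the RANK-1 DESCENT DECIDER S38i and the ANALYTIC CRUX AN-39 (file 1 of 2: statements only; file 2 = `F1Sign2/TwoSelmerCubicRayClassAtTwoKernel.lean` = kernel glue)

STATEMENTS ONLY, typer -ty g16 (cell charter: one file per candidate, statement-only, REF-gated).  Source: -an g21's cumulative sketch
`HOME/MEMO-an-data/g21/an38/lean/Sketch_v59.lean` **c6a2b75fa50a4645** (= `Sketch_v58.lean` dbe8fdd1637b6588 + l.506–592), blocks l.426–505 (§24.9)
and l.506–592 (§24.10) VERBATIM — decl bodies byte-identical (builder-verified), namespace `…F1Sign2.ANg21` and `open`s as the sketch, the sketch's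
three extra imports (`Literature…Selmer`, `…RootNumber`, `…BSDRankZeroDensity`) kept; filed as a NEW sibling of `F1Sign2/ModularDegreeCubicFieldAtTwo.lean`
(§24.1–§24.8, 518 l.) rather than an append because the storey is a self-contained candidate row that uses nothing of §24.1–§24.8 (only the AN-37 frame
`IsCubicTwoDivisionField` / `NoRationalTwoTorsion` of `SelfTwistAtTwo.lean` / `DescentSignAtTwo.lean`, by name) and §24.12–§24.14 (S38j–S38m) will append HERE.
Contents: the carrier `quadraticRayClassCharacters F 𝔪` (plain `def`, a `Set` of functions — the 2-rank of a ray class group typed WITHOUT a ray class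
group object), SIX conjecture-grade laws + the decider + the analytic crux as `@[conjecture] def … : Prop`: prime level S38f `TwoSelmerIsCubicRayClassAtQSq`,
S38h `RootNumberFromCubicRayClassAtQSq`, S38g `TwoSelmerWithinOneOfCubicRayClassAtQSq`; squarefree level with odd Tamagawa product S38f♮
`TwoSelmerIsCubicRayClassOddTamagawa`, S38h♮ `RootNumberFromCubicRayClassOddTamagawa`, S38g♮ `TwoSelmerWithinOneOfCubicRayClassOddTamagawa`,
**S38i `ShaTwoPrimaryTrivialIffCubicRayRankLeOne` (THE RANK-1 DESCENT DECIDER: `Ш(E)[2^∞] = 0 ⟺ rk₂ Cl_{𝔮²}(F₃) ≤ 1`)** and **AN-39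
`CubicRayRankLeOneForcesShaAnTwoAdicUnit` (THE ANALYTIC CRUX: on `{rk₂ Cl_{𝔮²}(F₃) ≤ 1}` the analytic order of `Ш` is a 2-adic unit)**; each docstring =
the sketch's VERBATIM + one «REF1-AUDIT §179» sentence + one «REF2-PLACEMENT v47 §19/§20» sentence.  NOT FILED (REF1 §179 duty 1): the sketch's support
`def RankOneOfAnalyticRankOne : Prop` (analytic rank 1 ⟹ rank 1) — it is a one-line corollary of the tree's Gross–Zagier–Kolyvagin fact
`rank_eq_analyticRank_of_analyticRank_le_one` (`Literature/NumberTheory/EllipticCurves/LeadingTerm.lean`); the glue `bsd2_on_cubicRayRankLeOne_subcell`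
(Kernel file) therefore takes that fact as its hypothesis (REF1's `bsd2_on_cubicRayRankLeOne_subcell'`), and -an's `rootNumberLaw_of_selmerLaw` (S38f + 2-Selmer
parity ⟹ S38h) is landed verbatim there, with REF1's sorry-free carrier certificates.
CENSUS = BC5 (MEMO-an §24.9–§24.11; -an ENGINES H4 j325599 (prime `N < 5·10⁵`) + H5 j325821 + H5e j325946 (composite / `2 ∥ N` squarefree `< 10⁵`) + **H6 j326580
= FULL CREMONA RANGE** (all squarefree `N < 5·10⁵`, odd torsion, odd `∏c_p`: 121 149 curves, class groups `bnfcertify`d; `MEMO-an-data/g21/jobH6/`, H6FOLD.txt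
3acfb84bedf0c126) + **S2/S2b j326520/j326678 UNCONDITIONAL 2-descent** (mwrank + ellrank; 646 prime-N + 2765 composite curves incl. all 365 `Ш_an ≥ 16` ramified
curves: law 325/325 + 221/221 + 2765/2765, `dim Ш[2] = 2` on every big-Ш curve)): Δ<0 ramified `dim Sel₂ = rk₂ Cl_{𝔮²}(F₃)` **70 269/70 269** and `w(E) = (−1)^T`
**70 269/70 269**; Δ>0 ramified `dim Sel₂ = T + [T ≢ rank]` **38 441/38 441**; decider S38i (`Ш_an` odd ⟺ `T ≤ 1`) **53 657/53 657** (sub-cell `T ≤ 1` = 99.47 %);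
with EVEN Tamagawa product every law fails (hypothesis load-bearing).  Three engines agree (bnrinit class-field side = rank + Ш_an Cremona side = mwrank).
REF1-AUDIT §179 (2026-08-29T06:48Z, `HOME/REF1-AUDIT-v1.md` 7f8711d077f5ab7c l.3226; evidence `HOME/REF1-data/b179/`: `Probe179.lean` rc 0, 6 goal probes,
7 sorry-free certificates, std axioms) VERDICT verbatim: «**8/8 SURVIVE** (S38f, S38h, S38g, S38f♮, S38h♮, S38g♮: conjecture-grade laws with a theorem-grade
proof path; S38i: CONSEQUENCE of S38f♮ ∧ S38g♮ given printed facts — file as conjecture now, glue later; AN-39: conjecture-grade analytic crux = BSD₂'s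
valuation clause on the sub-cell); carrier `quadraticRayClassCharacters` FAITHFUL (`Nat.card = 2^{rk₂ Cl_𝔪(F)}` for every modulus `𝔪 ≠ ⊤`; junk only at
`𝔪 = ⊤`, excluded by the laws' `Q ^ 2`); 0 killed, 0 not elaborating.»  REF1 THIRD ENGINE without class groups (pure Cremona, exact; `census179a.py`):
same-level mod-2-congruent pairs on the odd-Tamagawa / no-2-torsion / `F₃`-ramified frame share `w` 12 540/12 540 (Δ<0), `s₂` 12 376 equal / 0 differ,
`|Δ s₂| ≤ 1` 13 385/13 385 (Δ>0); **mutation «drop F₃ ramified» ⟹ `w` differs 948/1942 — LOAD-BEARING**; -an's ramification column re-derived E-side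
121 149/121 149; H6 fold reproduced to the row; modulus scan: `𝔮²` minimal, `(2)` data-equivalent on all 108 339 rows.
REF2-PLACEMENT v47 §19 (01fac7d820ae363b, 06:00Z) / §20 (ed6cac98b77920b7, 06:20Z) verbatim core: «S38g = **VARIANT** of a printed theorem (print's width-1
window is against the ARCHIMEDEAN `Cl_*(F₃,E)` — [cite: BarrerasalazarPacettiTornaria2021, Thm. 2.16, Def. 2.8]: `dim Cl_*(A_K,E)[2] ≤ dim Sel₂ ≤ … + [K:ℚ]`,
"if `K = ℚ` the order of the Selmer group is determined by the 2-torsion of `Cl_*(A_K,E)` and the root number", `Cl_* = Cl` at `Disc(E) < 0`;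
[cite: ChaoLi2018TwoSelmer, Thm. 1.1]; [cite: YooYu2022, Thm. 1.6, Thm. 1.10, Prop. 1.9, Thm. 1.11 (3)] — yours against the 2-adic `Cl_{𝔮²}`);
S38f = **NOT IN PRINT verbatim**, a SHARPENING of Li / BPT by a modulus AT 2 — content beyond print = "Li's root-number bit IS the `𝔮²`-ray bit of `F₃`" = S38h;
S38h = **NOT IN PRINT** (held text), conjecture-grade RECIPROCITY-TYPE law; S38f ⟺ S38h on the slice given 2-Selmer parity [cite: Monsky1996, Thm. 1.5]
[cite: DokchitserDokchitser2010ModSquares, Thm. 1.4] ⟹ **ONE obligation beyond print**, at squarefree level LEVEL-INDEPENDENT (S38h♮ = the cleanest new statement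
of the an-lens); **decider S38i: PRINT-ASSEMBLY, THEOREM-GRADE NOW in BPT's archimedean form** (`Ш(E)[2] = 0 ⟺ rk₂ Cl_*(F₃,E)[2] ≤ 1` from Thm 2.16 + GZK +
Cassels), the `Cl_{𝔮²}` form here is its VARIANT; AN-39 = the analytic half = the 2-part of BSD on the sub-cell, **OPEN IN PRINT** for `E(ℚ)[2] = 0`, non-CM,
`p = 2`; beyond-print theorem: no; BSD not proved.»  The Literature fact «BPT21 Thm 2.16 + Hyp. 2.1 + (†) Def. 1.6 + Def. 2.8 verbatim» asked for by -an
(D-an-118) and REF2 (§20) is a separate Literature filing (typer queue B).  BSD is not proved by this file; no item closed; PARTITION unchanged.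
LANDING NOTE (-ty g16, text only): kernel glue landed as `F1Sign2/TwoSelmerCubicRayClassAtTwoKernel.lean` (p705140); the BPT print input landed as
`Literature/NumberTheory/EllipticCurves/TwoSelmerRankCubicFieldClassGroup.lean` (p705338: `BPT2021.twoSelmerRank_clStar_bounds` = Thm 2.16 for `K = ℚ` with Def 1.6 (†),
Hyp 2.1, Def 2.8 `clStarQuadraticCharacters`, parity corollary proved); §24.12/§24.14/§24.15 (S38j…S38q, the MARKED law) continue in the sibling
`F1Sign2/MarkedTwoSelmerLawAtTwo.lean` (not appended here, to keep both files under the style cap); REF2 v47 §30 slot read of this file: CLEAN, two text-only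
cite nits folded (Monsky1996 → «Thm. 1.5» ×3; BrumerKramer1977 «§7» → BPT's own pointer «Cor. 3.3, Prop. 3.4, Lemma 3.5, Prop. 3.6, Lemma 4.2»).
-/

namespace Summit.BirchSwinnertonDyer.Rank1Residual.F1Sign2.ANg21

open Literature.NumberTheory.EllipticCurves Literature.NumberTheory.EllipticCurves.ModularForms UpperHalfPlane
open Literature.NumberTheory.EllipticCurves.Rank1Residual
open Summit.BirchSwinnertonDyer.Rank1Residual.F1Sign2 Summit.BirchSwinnertonDyer.Rank1Residual.F1Sign2.ANg17
open Summit.BirchSwinnertonDyer.Rank1Residual.F1Sign2.ANg18 Summit.BirchSwinnertonDyer.Rank1Residual.F1Sign2.ANg19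
open Summit.BirchSwinnertonDyer.Rank1Residual.F1Sign2.ANg20
open scoped Classical

/-! ## v58 (g21, S38f/S38g/S38h): the 2-Selmer storey of the dictionary — at prime level the whole
2-Selmer group of `E/ℚ` is a ray class group of the cubic 2-division field `F₃` of modulus `𝔮²`
(`𝔮` the ramified prime of `F₃` over 2).  ENGINE H4 (j325599) + Cremona: Δ<0, F₃ ramified:
`dim Sel₂(E) = rk₂ Cl_{𝔮²}(F₃)` on 2563/2563 (Ш-unambiguous) curves and the ROOT-NUMBER LAW
`w(E) = (−1)^{rk₂ Cl_{𝔮²}(F₃)}` on 2568/2568 (ranks 0–3); Δ>0, F₃ ramified: `dim Sel₂ − rk₂ Cl_{𝔮²} ∈ {0,1}`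
1446/1446.  Print neighbourhood: Barrera Salazar–Pacetti–Tornaría 2021 (arXiv:2001.02263) Thm 2.16
(`dim Cl_*(F₃,E)[2] ≤ dim Sel₂ ≤ dim Cl_*(F₃,E)[2] + 1`, `Cl_* = Cl` at Δ<0), Li 2019, Brumer–Kramer 1977 §7.
The 2-rank is typed WITHOUT a ray class group object: `#Hom(Cl_𝔪(F), ±1)` = the number of
quadratic ray class characters, i.e. of `χ : Ideal (𝓞 F) → ℤˣ` multiplicative on ideals coprime to `𝔪`,
`1` off them, and trivial on principal ideals `(a)`, `a ≡ 1 (mod 𝔪)`. -/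
section SelmerStorey
open NumberField

/-- The quadratic characters of the ray class group `Cl_𝔪(F)` (no archimedean part in the modulus),
as functions on integral ideals: multiplicative on ideals coprime to `𝔪`, `= 1` on ideals not coprime
to `𝔪` (normalisation), trivial on `(a)` for `a ≠ 0`, `a ≡ 1 (mod 𝔪)`.  `Nat.card` of this set is
`2 ^ rk₂ Cl_𝔪(F)`.
REF1-AUDIT §179 A2/A4 (`HOME/REF1-AUDIT-v1.md` l.3226, `REF1-data/b179/`): **FAITHFUL** — in bijection with `Hom(Cl_𝔪(F), ±1)`, hence finite with
`Nat.card = 2^{rk₂ Cl_𝔪(F)}`, for every modulus `⊥ < 𝔪 < ⊤` (paper proof §179 A2: every ray class contains an integral ideal coprime to `𝔪`; conditions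
(i)+(iii) make `χ` a function on `Cl_𝔪`, (ii) pins it off the coprime ideals).  **USE ONLY WITH `⊥ < 𝔪 < ⊤`:** at the trivial modulus `𝔪 = ⊤` the set
collapses to the trivial character (`⊥` is then «coprime to `𝔪`» and `⊥ * J = ⊥` forces `χ ≡ 1`) — `Nat.card = 1`, NOT `2^{rk₂ Cl(F)}` (kernel certificate
`ANg21.quadraticRayClassCharacters_top`, Kernel file); the laws' modulus `Q ^ 2` with `Q` prime and `2 ∈ Q ^ 2` is never `⊤`, and `Q ≠ ⊥`
(`sq_ne_top_of_isPrime`, `ne_bot_of_two_mem_sq`); the trivial character is always a member (`one_mem_quadraticRayClassCharacters`), so `Nat.card … ≤ 2`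
reads `rk₂ ≤ 1` and the `= 2 ^ k` binders below are instantiable.  Modulus scan (REF1 `check_fold179.txt`): `𝔮²` is the MINIMAL modulus for which the
laws below hold and `(2) = Ideal.span {2}` is data-equivalent on all 108 339 rows (a binder-free re-typing, not used: the intended proof is the local
computation at `v = 2`). -/
def quadraticRayClassCharacters (F : Type) [Field F] [NumberField F] (m : Ideal (𝓞 F)) :
    Set (Ideal (𝓞 F) → ℤˣ) :=
  {χ | (∀ I J : Ideal (𝓞 F), I ⊔ m = ⊤ → J ⊔ m = ⊤ → χ (I * J) = χ I * χ J) ∧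
       (∀ I : Ideal (𝓞 F), I ⊔ m ≠ ⊤ → χ I = 1) ∧
       (∀ a : 𝓞 F, a ≠ 0 → a - 1 ∈ m → χ (Ideal.span {a}) = 1)}

/-- **S38f** (Δ<0 2-Selmer law, prime level; 2563/2563, j325599 + Cremona allbsd): `N` prime, `Δ_E < 0`,
`E[2](ℚ) = 0`, `F₃` ramified at 2 with ramified prime `𝔮` (`2 ∈ 𝔮²`):  `#Sel₂(E/ℚ) = #Hom(Cl_{𝔮²}(F₃), ±1)`,
i.e. `dim_𝔽₂ Sel₂(E/ℚ) = rk₂ Cl_{𝔮²}(F₃)`.  BPT21 Thm 2.16 gives `∈ {rk₂ Cl(F₃), rk₂ Cl(F₃)+1}` decided by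
the root number; S38f says the modulus `𝔮²` absorbs the root number.
REF1-AUDIT §179: **SURVIVES** (conjecture-grade law with a theorem-grade proof path; frame audited A2: no minimality and no Tamagawa clause needed at
prime level — prime conductor + no rational 2-torsion ⟹ `c_N` odd, Mestre–Oesterlé, Cremona 5343/5343; `#Sel₂(E/ℚ)` is finite so no `Nat.card = 0` junk);
REF1 third engine (no class groups): congruent Δ<0 frame pairs share `s₂` 12 376 equal / 164 ambiguous / 0 differ; contained in S38f♮ below (prime ⟹
squarefree ∧ odd Tamagawa) — ONE obligation, not two.  REF2-PLACEMENT v47 §19: **NOT IN PRINT verbatim — a SHARPENING** of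
[cite: ChaoLi2018TwoSelmer, Thm. 1.1] / [cite: BarrerasalazarPacettiTornaria2021, Thm. 2.16, Def. 2.8] (print: `dim Sel₂ ∈ {rk₂ Cl(F₃), rk₂ Cl(F₃)+1}` at
`Δ < 0`, the bit fixed by the root number; `Cl_*` is an ARCHIMEDEAN modification, no modulus at 2) in a direction print does not take (a modulus AT 2):
content beyond print = «Li's root-number bit IS the `𝔮²`-ray bit of `F₃`» = S38h; S38f ⟺ S38h on the slice given 2-Selmer parity [cite: Monsky1996, Thm. 1.5]
[cite: DokchitserDokchitser2010ModSquares, Thm. 1.4] — ONE obligation beyond print; likely proof route (REF2, not a claim): pin `im δ_{ℚ₂}` for good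
reduction at 2 with `F₃ ⊗ ℚ₂` ramified ([cite: BrumerKramer1977, Cor. 3.3, Prop. 3.4, Lemma 3.5, Prop. 3.6, Lemma 4.2 (BPT 2021's own pointer, proof of Thm. 1.7)]; [cite: YooYu2022, Thm. 1.6, Thm. 1.10, Prop. 1.9]: «nice» gives `M₁ ⊂ im δ ⊂ M₂`,
«the even primes are exactly where `M₁`, `M₂` differ») and identify the unit-class condition with the `𝔮²`-ray condition by Kummer duality (= -an's
local lemma L𝔮², §24.13b); beyond-print theorem: no. -/
@[conjecture] def TwoSelmerIsCubicRayClassAtQSq : Prop :=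
  ∀ (W : WeierstrassCurve ℚ) [W.IsElliptic],
    Nat.Prime (W.conductorNorm ℤ) → W.Δ < 0 → NoRationalTwoTorsion W →
    ∀ (F : Type) [Field F] [NumberField F], IsCubicTwoDivisionField W F →
    ∀ Q : Ideal (𝓞 F), Q.IsPrime → (2 : 𝓞 F) ∈ Q ^ 2 →
      Nat.card (W.selmerGroup 2) = Nat.card (quadraticRayClassCharacters F (Q ^ 2))

/-- **S38h** (cubic ROOT-NUMBER LAW, prime level; 2568/2568 incl. ranks 2, 3): same frame:
`w(E) = (−1)^{rk₂ Cl_{𝔮²}(F₃)}` — the sign of the functional equation of `L(E,s)` is read off the cubic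
2-division field.  Equivalent to S38f given BPT21 Thm 2.16 + the 2-Selmer parity theorem
(Monsky; Dokchitser–Dokchitser `even_selmerRank_sub_torsionRank_iff`).
REF1-AUDIT §179: **SURVIVES**; REF1 third engine: `w(E) = w(E′)` on congruent Δ<0 frame pairs **12 540/12 540** (ss 2964, ordinary-ramified 1068,
`2 ∥ N` 8508), 0 violations; hypothesis mutation «drop `F₃` ramified at 2» ⟹ `w` differs on 948/1942 pairs — LOAD-BEARING; `rootNumber = ±1`
(`rootNumber_eq_one_or`), so `(−1)^k` is the right target.  REF2-PLACEMENT v47 §19/§20: **NOT IN PRINT (held text) — conjecture-grade RECIPROCITY-TYPE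
data law** (`w(E) = a_N(E)` = split/non-split at `N`, read off the 2-adic ray class parity of the cubic field); THE one obligation beyond print of this
storey (S38f ⟺ S38h given [cite: Monsky1996, Thm. 1.5] parity + print's window); nearest older print named by REF2 «verify before tagging»: Brumer–Kramer 1977 §7,
Washington 1987 (class-number parity vs rank parity for simplest cubics); beyond-print theorem: no. -/
@[conjecture] def RootNumberFromCubicRayClassAtQSq : Prop :=
  ∀ (W : WeierstrassCurve ℚ) [W.IsElliptic],
    Nat.Prime (W.conductorNorm ℤ) → W.Δ < 0 → NoRationalTwoTorsion W →
    ∀ (F : Type) [Field F] [NumberField F], IsCubicTwoDivisionField W F →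
    ∀ Q : Ideal (𝓞 F), Q.IsPrime → (2 : 𝓞 F) ∈ Q ^ 2 →
    ∀ k : ℕ, Nat.card (quadraticRayClassCharacters F (Q ^ 2)) = 2 ^ k → W.rootNumber = (-1) ^ k

/-- **S38g** (Δ>0 version, 1446/1446): `dim Sel₂(E/ℚ) − rk₂ Cl_{𝔮²}(F₃) ∈ {0, 1}` (the real place is
not absorbed by a 2-power modulus: no column of ENGINE H4 gives a parity law at Δ>0).
REF1-AUDIT §179: **SURVIVES**; REF1 third engine: `|s₂(E) − s₂(E′)| ≤ 1` on congruent Δ>0 frame pairs **13 385/13 385** (`w` differs in 7049 of them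
— the free archimedean bit is real), 0 violations.  REF2-PLACEMENT v47 §19: **VARIANT of a printed theorem** — print's width-1 window is against the
archimedean `Cl_*(F₃,E)` ([cite: BarrerasalazarPacettiTornaria2021, Thm. 2.16, Def. 2.8]; [cite: YooYu2022, Thm. 1.6]), this one against the 2-adic
`Cl_{𝔮²}`; the windows overlap (`rk₂ Cl_{𝔮²} − rk₂ Cl ∈ {0,1}` at `f(𝔮|2) = 1`) but are not the same statement; made EXACT at `Δ > 0` by marking the real
place of the leftmost 2-torsion point (S38l, MEMO-an §24.14; REF2 §26: that marking IS BPT's `P_*(E)`-condition [Lemma 2.4, Def. 2.8]); beyond-print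
theorem: no. -/
@[conjecture] def TwoSelmerWithinOneOfCubicRayClassAtQSq : Prop :=
  ∀ (W : WeierstrassCurve ℚ) [W.IsElliptic],
    Nat.Prime (W.conductorNorm ℤ) → 0 < W.Δ → NoRationalTwoTorsion W →
    ∀ (F : Type) [Field F] [NumberField F], IsCubicTwoDivisionField W F →
    ∀ Q : Ideal (𝓞 F), Q.IsPrime → (2 : 𝓞 F) ∈ Q ^ 2 →
    ∀ k : ℕ, Nat.card (quadraticRayClassCharacters F (Q ^ 2)) = 2 ^ k →
      Nat.card (W.selmerGroup 2) = 2 ^ k ∨ Nat.card (W.selmerGroup 2) = 2 ^ (k + 1)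

end SelmerStorey


/-! ## v59 (g21, S38f♮/S38g♮/S38h♮/S38i/AN-39): the 2-Selmer storey at SQUAREFREE level with ODD TAMAGAWA PRODUCT
(= the local hypothesis of the crux `RankOneAtTwoBigImageOddLocal`), and the DESCENT/ANALYTIC SPLIT of BSD₂ it affords.
ENGINE H4 (prime N < 5·10⁵) + H5 (odd composite squarefree N < 10⁵, j325821) + H5e (2 ∥ N squarefree < 10⁵, j325946) × Cremona allbsd,
restricted to odd Tamagawa product and `F₃` ramified at 2:
* Δ<0: `dim Sel₂(E) = rk₂ Cl_{𝔮²}(F₃)` 2563 + 6134 + 10383 = 19080/19080; root-number law 2568 + 6147 + 10403 = 19118/19118;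
* Δ>0: `dim Sel₂ − rk₂ Cl_{𝔮²}(F₃) ∈ {0,1}` 1446 + 3345 + 5293 = 10084/10084;
* RANK-1 DECIDER (analytic rank 1): `Ш_an` odd ⟺ `rk₂ Cl_{𝔮²}(F₃) ≤ 1` — Δ>0: 710 + 1717 + 2773 = 5200/5200, Δ<0: 1193 + 3024 + 4938 = 9155/9155;
  with EVEN Tamagawa product every one of these fails (e.g. Δ<0 exact law off by −2…3 on 5915/31577 rows) — the odd-`c_p` hypothesis is load-bearing,
  exactly as (†.iii) of Barrera Salazar–Pacetti–Tornaría 2021 (Thm 2.16). -/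
section DescentHalf
open NumberField

/-- **S38f♮**: squarefree level, odd Tamagawa product, Δ<0, `F₃` ramified at 2: `#Sel₂(E/ℚ) = #Hom(Cl_{𝔮²}(F₃), ±1)`. [19080/19080]
REF1-AUDIT §179: **SURVIVES** (`[IsGloballyMinimal]` needed by `tamagawaProduct`; `Odd W.tamagawaProduct` = BPT (†.iii) LOAD-BEARING — -an's
even-Tamagawa rows fail, off-frame congruent pairs differ ≈ 49 %; REF1 re-fold of H6 **70 004/70 004** + 265 rows with `16 ∣ Ш_an`, all with
`rk₂ − rank = 2`, i.e. `dim Ш[2] = 2` — settled `(ℤ/4)²`/`(ℤ/2^k)²` by -an's S2/S2b 2-descent; third engine `s₂` 12 376 equal / 0 differ); structural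
remark: a level-raised congruent partner has even `c_q`, so the frame is closed under same-level congruence only — exactly BPT's (†.iii).
REF2-PLACEMENT v47 §20: status as S38f — with S38h♮ **ONE obligation beyond print, now LEVEL-INDEPENDENT**; print inputs
[cite: BarrerasalazarPacettiTornaria2021, Thm. 2.16, Hyp. 2.1, Def. 1.6] (odd `∏c_p` = (†.iii) at odd bad primes, good reduction at 2 = (†.iv)) and, for
`2 ∥ N`, [cite: YooYu2022, Thm. 1.11 (3)] («multiplicative at `v ∣ 2` with `v(D)` odd ⟹ nice»); CHEAPEST FALSIFIER unconditional and run: -an ENGINE S2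
j326520 / S2b j326678 (mwrank + ellrank 2-descent) 325/325 + 2765/2765; beyond-print theorem: no. -/
@[conjecture] def TwoSelmerIsCubicRayClassOddTamagawa : Prop :=
  ∀ (W : WeierstrassCurve ℚ) [W.IsElliptic] [W.IsGloballyMinimal],
    Squarefree (W.conductorNorm ℤ) → Odd W.tamagawaProduct → W.Δ < 0 → NoRationalTwoTorsion W →
    ∀ (F : Type) [Field F] [NumberField F], IsCubicTwoDivisionField W F →
    ∀ Q : Ideal (𝓞 F), Q.IsPrime → (2 : 𝓞 F) ∈ Q ^ 2 →
      Nat.card (W.selmerGroup 2) = Nat.card (quadraticRayClassCharacters F (Q ^ 2))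

/-- **S38h♮** (root-number law, squarefree level, odd Tamagawa product, Δ<0, `F₃` ramified at 2):
`w(E) = (−1)^{rk₂ Cl_{𝔮²}(F₃)}`. [19118/19118]
REF1-AUDIT §179: **SURVIVES**; REF1 re-fold of H6 **70 269/70 269**; third engine 12 540/12 540, ramification load-bearing 948/1942; E-side corollary
(→ -es and -desc): on the odd-Tamagawa ramified frame `w` and `#Sel₂` are functions of `ρ̄_{E,2}` (0/26 040 violations; = -an's S38k, §24.12).
REF2-PLACEMENT v47 §20 (a): **NOT IN PRINT (held), conjecture-grade — the cleanest new statement of the an-lens: a LEVEL-INDEPENDENT reciprocity-type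
law `w(E) = (−1)^{rk₂ Cl_{𝔮²}(F₃)}` on {`E(ℚ)[2] = 0`, odd `∏c_p`, `F₃` ramified at 2, `Δ < 0`}, a pure statement about cubic fields attached to
semistable curves (`w(E) = ∏` local signs is elementary); falsifier unconditional and run (S2); beyond-print theorem: no.** -/
@[conjecture] def RootNumberFromCubicRayClassOddTamagawa : Prop :=
  ∀ (W : WeierstrassCurve ℚ) [W.IsElliptic] [W.IsGloballyMinimal],
    Squarefree (W.conductorNorm ℤ) → Odd W.tamagawaProduct → W.Δ < 0 → NoRationalTwoTorsion W →
    ∀ (F : Type) [Field F] [NumberField F], IsCubicTwoDivisionField W F →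
    ∀ Q : Ideal (𝓞 F), Q.IsPrime → (2 : 𝓞 F) ∈ Q ^ 2 →
    ∀ k : ℕ, Nat.card (quadraticRayClassCharacters F (Q ^ 2)) = 2 ^ k → W.rootNumber = (-1) ^ k

/-- **S38g♮** (Δ>0, squarefree level, odd Tamagawa product, `F₃` ramified at 2): `dim Sel₂ − rk₂ Cl_{𝔮²}(F₃) ∈ {0,1}`. [10084/10084]
REF1-AUDIT §179: **SURVIVES**; REF1 re-fold of H6 **38 335/38 335** (`s₂ − rk₂ = 0`: 16 235, `= 1`: 22 100); third engine 13 385/13 385.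
REF2-PLACEMENT v47 §20/§26: **VARIANT** of [cite: BarrerasalazarPacettiTornaria2021, Thm. 2.16] (window against `Cl_{𝔮²}` instead of `Cl_*`); exact
form = S38l (§24.14: archimedean marking = BPT's `P_*(E)` [Lemma 2.4, Def. 2.8], 38 441/38 441); beyond-print theorem: no. -/
@[conjecture] def TwoSelmerWithinOneOfCubicRayClassOddTamagawa : Prop :=
  ∀ (W : WeierstrassCurve ℚ) [W.IsElliptic] [W.IsGloballyMinimal],
    Squarefree (W.conductorNorm ℤ) → Odd W.tamagawaProduct → 0 < W.Δ → NoRationalTwoTorsion W →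
    ∀ (F : Type) [Field F] [NumberField F], IsCubicTwoDivisionField W F →
    ∀ Q : Ideal (𝓞 F), Q.IsPrime → (2 : 𝓞 F) ∈ Q ^ 2 →
    ∀ k : ℕ, Nat.card (quadraticRayClassCharacters F (Q ^ 2)) = 2 ^ k →
      Nat.card (W.selmerGroup 2) = 2 ^ k ∨ Nat.card (W.selmerGroup 2) = 2 ^ (k + 1)

/-- **S38i = the RANK-1 DESCENT DECIDER** (both signs of Δ; squarefree level, odd Tamagawa product, `E[2](ℚ) = 0`,
`F₃` ramified at 2, analytic rank 1): `Ш(E)[2^∞] = 0 ⟺ rk₂ Cl_{𝔮²}(F₃) ≤ 1` (i.e. `#Hom(Cl_{𝔮²}(F₃), ±1) ≤ 2`).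
[Ш_an-form: Δ>0 5200/5200, Δ<0 9155/9155.]  THEOREM-GRADE PATH: S38f♮/S38g♮ (BPT21 Thm 2.16 made exact at `v = 2`) + 2-Selmer parity
(`even_selmerRank_sub_torsionRank_iff`) + GZK (`rank E(ℚ) = 1`) + `Ш[2] = 0 ⟹ Ш[2^∞] = 0`.
REF1-AUDIT §179: **SURVIVES — a CONSEQUENCE of S38f♮ ∧ S38g♮** given 2-Selmer parity (`even_selmerRank_sub_torsionRank_iff`), GZK
(`rank_eq_analyticRank_of_analyticRank_le_one`: rank 1 and `Ш` finite) and the Kummer sequence `s₂ = rank + dim Ш[2]` (6-line paper proof §179 (b):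
Δ<0 `s₂ = rk`; Δ>0 `s₂` odd and `∈ {rk, rk+1}`; `Ш[2] = 0 ⟺ Ш[2^∞] = 0`) — NO separate obligation; filed `@[conjecture]` because it is the row the route
consumes, the derivation (via `exists_kummerMap` / `map_torsionH1ToH1_selmerGroup` of `Selmer.lean`) is the first kernel target; H6 **53 657/53 657**
(sub-cell `T ≤ 1` = 99.47 % of the rank-1 slice); `Nat.card (Ш[2^∞]) = 1` ⟺ trivial (an infinite group has `Nat.card = 0`).  REF2-PLACEMENT v47 §20 (b):
**PRINT-ASSEMBLY, THEOREM-GRADE NOW in the ARCHIMEDEAN form** — for analytic rank 1, `E(ℚ)[2] = 0`, Hyp. 2.1: `dim Sel₂` is odd (GZK + Cassels) and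
`∈ {T_*, T_*+1}`, `T_* = rk₂ Cl_*(F₃,E)[2]` [cite: BarrerasalazarPacettiTornaria2021, Thm. 2.16, Hyp. 2.1, Def. 2.8] ⟹ `Ш(E)[2] = 0 ⟺ T_* ≤ 1`
(`Cl_* = Cl` at `Δ < 0`); THIS `Cl_{𝔮²}` form is the VARIANT (prove `min(rk₂ Cl_{𝔮²}, 2) = min(rk₂ Cl_*, 2)` on the slice — data 14 355/14 355 — or keep it
conjecture-grade); LEAD 23715: state the route's descent half with `Cl_*(F₃,E)` and it closes by Literature assembly once BPT Thm 2.16 is typed (typer queue);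
neither form is a beyond-print theorem. -/
@[conjecture] def ShaTwoPrimaryTrivialIffCubicRayRankLeOne : Prop :=
  ∀ (W : WeierstrassCurve ℚ) [W.IsElliptic] [W.IsGloballyMinimal],
    Squarefree (W.conductorNorm ℤ) → Odd W.tamagawaProduct → NoRationalTwoTorsion W →
    ∀ (F : Type) [Field F] [NumberField F], IsCubicTwoDivisionField W F →
    ∀ Q : Ideal (𝓞 F), Q.IsPrime → (2 : 𝓞 F) ∈ Q ^ 2 →
    W.analyticRank = 1 →
      (Nat.card (AddCommGroup.primaryComponent W.sha 2) = 1 ↔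
        Nat.card (quadraticRayClassCharacters F (Q ^ 2)) ≤ 2)

/-- **AN-39 = the ANALYTIC CRUX left by the decider** (the `−an` lens's half): on the sub-cell `rk₂ Cl_{𝔮²}(F₃) ≤ 1`
(5172/5200 = 99.5 % of the Δ>0 rank-1 odd-Tamagawa ramified slice; 9141/9155 at Δ<0) the analytic order of Ш is a 2-ADIC UNIT:
`v₂( L'(E,1) · #E(ℚ)_tors² / (Ω_E · ∏ c_p · Reg_E) ) = 0`.  With odd torsion and odd `∏ c_p` this is `v₂(L'(E,1)/(Ω_E Reg_E)) = 0`
— a statement about ONE analytic quantity on a set cut out by a class-field condition on `ℚ(E[2])`.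
REF1-AUDIT §179: **SURVIVES — conjecture-grade ANALYTIC CRUX** = the valuation clause of `bsdp_iff W 2` with `#Ш[2^∞] = 1` on the sub-cell (the glue
`ANg21.bsd2_on_cubicRayRankLeOne_subcell` replays, Kernel file); `shaAn` has nonzero denominator at analytic rank 1, so the `padicValRat 2 0 = 0` junk
cannot fire; `Odd W.torsionOrder` is implied by `NoRationalTwoTorsion W` (kept for frame-matching with H6); H6: all 53 373 frame rows have `v₂(Ш_an) = 0`.
REF2-PLACEMENT v47 §20 (c): = the ANALYTIC HALF = literally the 2-part of BSD on the sub-cell given S38i — **OPEN IN PRINT** for `E(ℚ)[2] = 0`, non-CM,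
`p = 2` (printed 2-part results at analytic rank ≤ 1 cover rational-2-torsion / Neumann–Setzer / CM / quadratic-twist families and the (⋆)-conditional
2-converse [cite: KrizLi2019, Thm. 5.1]; none gives `v₂(Ш_an) = 0 ⟸ T ≤ 1` here); proof BSD₂-hard unless a one-sided 2-adic Kato/IMC bound is available on
the S₃-image slice (-imc's question: that would turn AN-39 into «BSD₂ ≤» + the decider); beyond-print theorem: no; BSD not proved. -/
@[conjecture] def CubicRayRankLeOneForcesShaAnTwoAdicUnit : Prop :=
  ∀ (W : WeierstrassCurve ℚ) [W.IsElliptic] [W.IsGloballyMinimal],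
    Squarefree (W.conductorNorm ℤ) → Odd W.tamagawaProduct → Odd W.torsionOrder → NoRationalTwoTorsion W →
    ∀ (F : Type) [Field F] [NumberField F], IsCubicTwoDivisionField W F →
    ∀ Q : Ideal (𝓞 F), Q.IsPrime → (2 : 𝓞 F) ∈ Q ^ 2 →
    W.analyticRank = 1 → Nat.card (quadraticRayClassCharacters F (Q ^ 2)) ≤ 2 →
      ∃ q : ℚ, shaAn W = (q : ℂ) ∧ padicValRat 2 q = 0

end DescentHalf

end Summit.BirchSwinnertonDyer.Rank1Residual.F1Sign2.ANg21
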